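import Mathlib
import HarnessLib
import Literature.Analysis.FluidPDE.TaoEnstrophyLocalisation
import Literature.Analysis.FluidPDE.GigaMiura2011UnidirectionalVorticityHolds
import Literature.Analysis.FluidPDE.BarkerPrange2020VorticityAlignmentTypeIHolds
import Literature.Analysis.FluidPDE.KNSSTypeIRateLiouvilleHolds
import Summits.NavierStokesRegularity.NavierStokesRegularity.Theorems.HalfSpaceWindowDoorCirculationCarryingRigidityDefs
import Summits.NavierStokesRegularity.NavierStokesRegularity.Theorems.PoloidalWindowDoorPoloidalWindowRigidityWindow
import Summits.NavierStokesRegularity.NavierStokesRegularity.Theorems.PoloidalWindowDoorPoloidalWindowRigidityForwardSmallness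
import Summits.NavierStokesRegularity.NavierStokesRegularity.Theorems.SqueezeCycleExtremalElementExistsRescale
import Summits.NavierStokesRegularity.NavierStokesRegularity.Theorems.SqueezeCycleExtremalElementExistsExtraction
import Summits.NavierStokesRegularity.NavierStokesRegularity.Theorems.SymmetryModuliCountSymmetricLiouvillePeriodicBlowdown
import Summits.NavierStokesRegularity.NavierStokesRegularity.Theorems.SymmetryModuliCountSymmetricLiouvilleRotationCovariance

/-!
# Route `HalfSpaceWindowDoor`, crux `CirculationCarryingRigidity` (stmt-NavierStokesRegularity-25311) —
# census brick: NO ASYMPTOTIC ALIGNMENT — the far-past HORIZONTAL-VORTICITY FLOOR of the Type-I ancient class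

LEAD ns-hsw-p1 g7 (cell pub-ns-dss), `--supports stmt-NavierStokesRegularity-25311 --as helper`; sequel of
`…CirculationCarryingRigidityPeriodicStratum` (p665830: the periodic stratum is `{0}`).  The research stub of the crux is
W6 `HemisphereLiouvilleE3` (closed-hemisphere door-class profiles are poloidal); the census of the two cards
(`Cruxes/CirculationCarryingRigidity/Lines/eddy_torque.md`, `Lines/gauss_swirl.md`) reads the enemy's collapse mechanism as
eddy TILTING of horizontal vorticity `ω_h = (ω₁, ω₂)` into `ω₃ ≥ 0`, while `ω_h` itself «never enters» the Gaussian law.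
This file types the statement that the tilting fuel can never run out AT SCALE: a blow-down (far-past tangent flow) argument
in the Type-I ancient Oseen-mild class, SIGN-FREE.

* `eq_zero_of_lineInvariant` — a Type-I ancient mild field (`IsTypeIAncientMild C`) invariant under all translations along
  one direction `e ≠ 0` vanishes identically (rotation of `e` onto the `x₂`-axis by `stub_rotationCovariance`, backward time
  shift, and the tree's PROVED `KNSS2009_typeI_rate_liouville_holds` = KNSS 2009 Thm 5.1 + Rem 6.1 + the caloric axial
  half).
* `lineInvariant_of_curl_parallel_slice`, `eq_zero_of_curl_parallel_slice` — **ANCIENT BARKER–PRANGE**: if ONE slice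
  `W(s₀)`, `s₀ < 0`, of a Type-I ancient mild field has its vorticity everywhere parallel to a fixed `e ≠ 0`, then `W ≡ 0` on the
  open lower slab.  Slice lemma `translationInvariant_of_curl_parallel` (Giga–Miura / Barker–Prange: bounded, divergence-free,
  curl ∥ `e` ⇒ invariant along `e`) ⇒ forward propagation `IsTypeIAncientMild.comp_add_eq_after` (uniqueness of bounded
  Oseen-mild solutions) ⇒ BACKWARD propagation by the real-analyticity in time of the class (`analyticOnNhd_uncurry` +
  identity theorem on `(−∞,0)`) ⇒ `eq_zero_of_lineInvariant`.  Unlike the tree's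
  `not_isBackwardSingularPoint_of_typeIAncientMild_of_curl_parallel_slice` (which needs the suitable-weak/pressure package for a
  second zoom and concludes non-singularity), the ancient class needs no pressure and the conclusion is triviality.
* `eq_zero_of_frequently_vertical_vorticity` — **MAIN (far-past alignment kills)**: a door-class profile (Type-I time rate,
  continuity on the open slab, unit-viscosity Oseen–Duhamel identity, divergence-free slices) whose scale-invariant horizontal
  vorticity is small at SOME time below every `T` — `∀ ε>0 ∀ T ∃ t<T ∀ x, (−t)|ω₁(t,x)| ≤ ε ∧ (−t)|ω₂(t,x)| ≤ ε` — is `≡ 0`.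
  Proof: if not, `exists_uniformly_nonsmall` (K2-p1) puts a bad point `ε₀ < √(−t)‖v(t,x_t)‖` on EVERY early slice; at the
  nearly-aligned times `t_n → −∞` zoom by `λ_n = √(−t_n)` about `x_{t_n}` (`isTypeIAncientMild_zoom`); an F3-limit
  (`exists_tendsto_of_isTypeIAncientMild_seq`, with pointwise convergence of the gradients, hence of `curl = curlCLM ∘ D`) is a
  class member `W` with `‖W(−1,0)‖ ≥ ε₀` and `curl W(−1) ∥ e₃` everywhere — contradicting `eq_zero_of_curl_parallel_slice`.
* `farPast_horizontalVorticity_floor` — contrapositive: a NONTRIVIAL door-class profile carries `ε₁ > 0` and `T < 0` with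
  `∃ x, ε₁ < (−t)(|ω₁(t,x)| + |ω₂(t,x)|)` on EVERY slice `t < T`.
* Census corollaries for the crux (closed hemisphere NOT needed): `inner_curl_e3_eq_zero_of_frequently_vertical_vorticity`
  (W6 on the stratum «frequently asymptotically vertical vorticity»), `hemisphereLiouvilleE3_of_frequently_vertical_vorticity`
  (bundled `InDoorClass` form), `enemy_horizontalVorticity_floor` (a circulation-carrying closed-hemisphere profile — the enemy
  of W6 — has the floor).  By `stub_rotate`-type covariance the same holds for the vorticity component orthogonal to ANY fixed
  direction; the `e₃` frame is the crux's.

Census meaning.  Dead strata gain {vorticity asymptotically vertical at scale along a sequence of far-past times} ⊃ {aligned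
on one slice} ⊃ {2.5-D, periodic}.  The enemy of W6, read with `…ExtremalProfile` / `…SubcriticalStretching` (critical
stretching at the extremal point) and this file: at ALL sufficiently early times it carries horizontal vorticity of
scale-invariant size `≥ ε₁` somewhere — the raw material of the tilting torque `ℛ_tilt` of `eddy_torque` — and that material
is not inherited from any aligned, periodic or line-invariant skeleton in the far past.

WHAT THIS IS NOT: not a statement about Navier–Stokes regularity (Clay A); door statements are regularity CRITERIA about
HYPOTHETICAL blow-up profiles (KNSS ancient mild solutions).  No item is closed by this file; 25311 stays OPEN at its research stub.
-/

noncomputable section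

-- the summit and its single sub-problem share the name (CONVENTIONS §1), as in every Theorems file
set_option linter.dupNamespace false

namespace Summit.NavierStokesRegularity.NavierStokesRegularity.Theorems.HalfSpaceWindowDoorCirculationCarryingRigidityHorizontalVorticityFloor

open MeasureTheory Set Function Filter Topology
open scoped RealInnerProductSpace InnerProductSpace
open Literature.Analysis Literature.Analysis.FluidPDE
open Summit.NavierStokesRegularity.NavierStokesRegularity.Theses.HalfSpaceWindowDoor
open Summit.NavierStokesRegularity.NavierStokesRegularity.Theorems.HalfSpaceWindowDoorCirculationCarryingRigidityDefs
open Summit.NavierStokesRegularity.NavierStokesRegularity.Theorems.PoloidalWindowDoorPoloidalWindowRigidityWindow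
  (isTypeIAncientMild_of_class)
open Summit.NavierStokesRegularity.NavierStokesRegularity.Theorems.LocalSineTubeDoorProfileAlignedWindowRigidityAncient
  (analyticOnNhd_uncurry bdd_of_hasTypeITimeDecay)
open Summit.NavierStokesRegularity.NavierStokesRegularity.Theorems.PoloidalWindowDoorPoloidalWindowRigidityForwardSmallness
  (exists_uniformly_nonsmall)
open Summit.NavierStokesRegularity.NavierStokesRegularity.Theorems
  (exists_tendsto_of_isTypeIAncientMild_seq isTypeIAncientMild_zoom zoom_apply)
open Summit.NavierStokesRegularity.NavierStokesRegularity.Theorems.SymmetryModuliCountSymmetricLiouville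
  (stub_rotationCovariance exists_linearIsometryEquiv_map_eq_smul_single sqrt_mul_div_sqrt_shift_le)

variable {C : ℝ}

/-! ### Line-invariant members of the class vanish -/

/-- **A Type-I ancient mild field invariant under all translations along one direction `e ≠ 0` is `≡ 0`.**  Rotate `e`
onto the `x₂`-axis (`stub_rotationCovariance`), shift time backward by `δ > 0` to make the field bounded on the whole slab,
and apply the tree's PROVED Liouville step of KNSS Thm 6.2 (`KNSS2009_typeI_rate_liouville_holds`). -/
theorem eq_zero_of_lineInvariant {W : ℝ → (EuclideanSpace ℝ (Fin 3)) → (EuclideanSpace ℝ (Fin 3))} (hW : IsTypeIAncientMild C W) {e : (EuclideanSpace ℝ (Fin 3))} (he : e ≠ 0)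
    (hinv : ∀ t < 0, ∀ (x : (EuclideanSpace ℝ (Fin 3))) (θ : ℝ), W t (x + θ • e) = W t x) : ∀ t < 0, ∀ x, W t x = 0 := by
  obtain ⟨L, hL⟩ := exists_linearIsometryEquiv_map_eq_smul_single e
  have hC : 0 ≤ C := hW.nonneg
  have hne : ‖e‖ ≠ 0 := norm_ne_zero_iff.2 he
  -- the rotated field, invariant along `e₂`
  set U : ℝ → (EuclideanSpace ℝ (Fin 3)) → (EuclideanSpace ℝ (Fin 3)) := fun t x => L (W t (L.symm x)) with hU
  have hUcl : IsTypeIAncientMild C U := stub_rotationCovariance C L W hW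
  have hLsymm : L.symm (EuclideanSpace.single (1 : Fin 3) (1 : ℝ)) = ‖e‖⁻¹ • e := by
    have h1 : L (‖e‖⁻¹ • e) = EuclideanSpace.single (1 : Fin 3) (1 : ℝ) := by
      rw [map_smul, hL, smul_smul, inv_mul_cancel₀ hne, one_smul]
    rw [← h1, L.symm_apply_apply]
  have hUinv : ∀ t < 0, ∀ (x : (EuclideanSpace ℝ (Fin 3))) (δ : ℝ), U t (x + EuclideanSpace.single (1 : Fin 3) δ) = U t x := by
    intro t ht x δ
    simp only [hU]
    rw [FluidPDE.single_one_eq_smul, map_add, map_smul, hLsymm, smul_smul, hinv t ht]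
  -- for each target time `t < 0`, shift by `δ = -t/2`
  intro t ht x
  set δ : ℝ := -t / 2 with hδ
  have hδ0 : 0 < δ := by rw [hδ]; linarith
  set V : ℝ → (EuclideanSpace ℝ (Fin 3)) → (EuclideanSpace ℝ (Fin 3)) := fun τ => U (τ - δ) with hV
  have hVcl : IsTypeIAncientMild C V := hUcl.comp_sub_right hδ0.le
  have hVb : ∃ K : ℝ, ∀ τ < 0, ∀ y, ‖V τ y‖ ≤ K := by
    refine ⟨C / Real.sqrt δ, fun τ hτ y => (hUcl.norm_le (t := τ - δ) (by linarith) y).trans ?_⟩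
    exact div_le_div_of_nonneg_left hC (Real.sqrt_pos.2 hδ0) (Real.sqrt_le_sqrt (by linarith))
  have hVi : ∀ τ < 0, ∀ (y : (EuclideanSpace ℝ (Fin 3))) (d : ℝ), V τ (y + EuclideanSpace.single (1 : Fin 3) d) = V τ y :=
    fun τ hτ y d => hUinv (τ - δ) (by linarith) y d
  have hVr : ∀ τ < 0, ∀ y, Real.sqrt (-τ) * ‖V τ y‖ ≤ C := by
    intro τ hτ y
    calc Real.sqrt (-τ) * ‖V τ y‖ ≤ Real.sqrt (-τ) * (C / Real.sqrt (-(τ - δ))) :=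
          mul_le_mul_of_nonneg_left (hUcl.norm_le (by linarith) y) (Real.sqrt_nonneg _)
      _ ≤ C := sqrt_mul_div_sqrt_shift_le hC hδ0.le hτ
  have hV0 : ∀ τ < 0, ∀ y, V τ y = 0 :=
    KNSS2009_typeI_rate_liouville_holds hVcl.continuousOn_uncurry hVb
      (fun τ hτ => hVcl.isWeaklyDivFree hτ) (fun s τ hsτ hτ y => hVcl.mild_eq_heatExtension hsτ hτ y) hVi hVr
  -- read off `W t x = 0`
  have h1 : V (t + δ) (L x) = 0 := hV0 (t + δ) (by rw [hδ]; linarith) (L x)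
  simp only [hV, hU, add_sub_cancel_right, L.symm_apply_apply] at h1
  exact L.injective (by rw [h1, map_zero])

/-! ### Ancient Barker–Prange: alignment on one slice forces triviality -/

/-- **Alignment on one slice ⇒ invariance along the alignment direction at all times.**  If the slice `W(s₀)`, `s₀ < 0`, of
a Type-I ancient mild field has `curl W(s₀)(y) ∥ e` for every `y` (`e ≠ 0`), then `W(t, x + θe) = W(t, x)` for all `t < 0`:
at `s₀` by the slice lemma `translationInvariant_of_curl_parallel`, after `s₀` by forward uniqueness
(`IsTypeIAncientMild.comp_add_eq_after`), before `s₀` by real-analyticity in time (identity theorem on `(−∞, 0)`). -/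
theorem lineInvariant_of_curl_parallel_slice {W : ℝ → (EuclideanSpace ℝ (Fin 3)) → (EuclideanSpace ℝ (Fin 3))} (hW : IsTypeIAncientMild C W)
    {s₀ : ℝ} (hs₀ : s₀ < 0) {e : (EuclideanSpace ℝ (Fin 3))} (he : e ≠ 0) (hpar : ∀ y, ∃ a : ℝ, curl (W s₀) y = a • e) :
    ∀ t < 0, ∀ (x : (EuclideanSpace ℝ (Fin 3))) (θ : ℝ), W t (x + θ • e) = W t x := by
  -- Step A: the slice
  have hA : ∀ (x : (EuclideanSpace ℝ (Fin 3))) (θ : ℝ), W s₀ (x + θ • e) = W s₀ x := fun x θ =>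
    translationInvariant_of_curl_parallel ((hW.contDiff_slice hs₀).of_le (by norm_cast))
      (hW.isDivFree hs₀) ⟨C / Real.sqrt (-s₀), fun y => hW.norm_le hs₀ y⟩ he hpar x θ
  -- Step B: forward in time
  have hB : ∀ θ : ℝ, ∀ t, s₀ < t → t < 0 → ∀ x : (EuclideanSpace ℝ (Fin 3)), W t (x + θ • e) = W t x := fun θ =>
    hW.comp_add_eq_after hs₀ (b := θ • e) fun x => hA x θ
  -- Step C: backward by analyticity in time
  have han : AnalyticOnNhd ℝ (uncurry W) (Iio (0 : ℝ) ×ˢ univ) :=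
    analyticOnNhd_uncurry hW.continuousOn_uncurry (bdd_of_hasTypeITimeDecay hW.hasTypeITimeDecay)
      fun s t hst ht y => hW.mild_eq_heatExtension hst ht y
  intro t ht x θ
  have hline : ∀ z : (EuclideanSpace ℝ (Fin 3)), AnalyticOnNhd ℝ (fun τ : ℝ => W τ z) (Iio (0 : ℝ)) := fun z =>
    han.comp₂ analyticOnNhd_id analyticOnNhd_const fun _ hτ => mk_mem_prod hτ (mem_univ _)
  have hdiff : AnalyticOnNhd ℝ (fun τ : ℝ => W τ (x + θ • e) - W τ x) (Iio (0 : ℝ)) :=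
    (hline (x + θ • e)).sub (hline x)
  have hev : (fun τ : ℝ => W τ (x + θ • e) - W τ x) =ᶠ[𝓝 (s₀ / 2)] 0 := by
    filter_upwards [Ioo_mem_nhds (show s₀ < s₀ / 2 by linarith) (show s₀ / 2 < 0 by linarith)] with τ hτ
    simp only [Pi.zero_apply, sub_eq_zero]
    exact hB θ τ hτ.1 hτ.2 x
  have h0 : s₀ / 2 ∈ Iio (0 : ℝ) := show s₀ / 2 < 0 by linarith
  have h := hdiff.eqOn_zero_of_preconnected_of_eventuallyEq_zero isPreconnected_Iio h0 hev ht
  simpa [sub_eq_zero] using h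

/-- **ANCIENT BARKER–PRANGE.**  A Type-I ancient mild field one of whose slices has vorticity everywhere parallel to a fixed
`e ≠ 0` vanishes identically on the open lower slab. -/
theorem eq_zero_of_curl_parallel_slice {W : ℝ → (EuclideanSpace ℝ (Fin 3)) → (EuclideanSpace ℝ (Fin 3))} (hW : IsTypeIAncientMild C W)
    {s₀ : ℝ} (hs₀ : s₀ < 0) {e : (EuclideanSpace ℝ (Fin 3))} (he : e ≠ 0) (hpar : ∀ y, ∃ a : ℝ, curl (W s₀) y = a • e) :
    ∀ t < 0, ∀ x, W t x = 0 :=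
  eq_zero_of_lineInvariant hW he (lineInvariant_of_curl_parallel_slice hW hs₀ he hpar)

/-! ### The blow-down: frequently vertical vorticity kills -/

/-- `curl` along a pointwise-convergent sequence of gradients (`curl = curlCLM ∘ D`). -/
theorem tendsto_curl_of_tendsto_fderiv {w : ℕ → (EuclideanSpace ℝ (Fin 3)) → (EuclideanSpace ℝ (Fin 3))} {W : (EuclideanSpace ℝ (Fin 3)) → (EuclideanSpace ℝ (Fin 3))} {x : (EuclideanSpace ℝ (Fin 3))}
    (h : Tendsto (fun j => fderiv ℝ (w j) x) atTop (𝓝 (fderiv ℝ W x))) :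
    Tendsto (fun j => curl (w j) x) atTop (𝓝 (curl W x)) := by
  simp_rw [curl_eq_curlCLM]
  exact (curlCLM.continuous.tendsto _).comp h

/-- A vector of `ℝ³` whose first two coordinates vanish is a multiple of `e₃`. -/
theorem eq_smul_e3_of_apply_eq_zero {w : (EuclideanSpace ℝ (Fin 3))} (h0 : w 0 = 0) (h1 : w 1 = 0) : w = w 2 • e3 := by
  ext i
  fin_cases i <;> simp [e3, h0, h1]

/-- **MAIN — frequently (asymptotically) vertical vorticity kills, class form.**  Let `v ∈ IsTypeIAncientMild C`.  If below
every `T` there is a time `t` at which the scale-invariant horizontal vorticity is `ε`-small everywhere, for every `ε > 0` —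
`∀ ε>0 ∀ T ∃ t<T ∀ x, (−t)|curl v(t)(x)₀| ≤ ε ∧ (−t)|curl v(t)(x)₁| ≤ ε` — then `v ≡ 0` (module docstring for the proof). -/
theorem eq_zero_of_frequently_vertical_vorticity_class {v : ℝ → (EuclideanSpace ℝ (Fin 3)) → (EuclideanSpace ℝ (Fin 3))} (hv : IsTypeIAncientMild C v)
    (hfreq : ∀ ε > 0, ∀ T : ℝ, ∃ t < T, ∀ x,
      (-t) * |curl (v t) x 0| ≤ ε ∧ (-t) * |curl (v t) x 1| ≤ ε) :
    ∀ t < 0, ∀ x, v t x = 0 := by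
  by_contra hne
  push Not at hne
  obtain ⟨t₁, ht₁, x₁, hx₁⟩ := hne
  obtain ⟨ε₀, hε₀, T₀, hT₀, hbad⟩ := exists_uniformly_nonsmall hv.hasTypeITimeDecay
    (fun s t hst ht x => hv.mild_eq_heatExtension hst ht x) ⟨t₁, ht₁, x₁, hx₁⟩
  -- nearly aligned early times `t_n < min T₀ (-(n+1))` with bad points `x_n`
  have hch : ∀ n : ℕ, ∃ tx : ℝ × (EuclideanSpace ℝ (Fin 3)), tx.1 < T₀ ∧ tx.1 < -((n : ℝ) + 1) ∧
      (∀ x, (-tx.1) * |curl (v tx.1) x 0| ≤ 1 / ((n : ℝ) + 1) ∧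
        (-tx.1) * |curl (v tx.1) x 1| ≤ 1 / ((n : ℝ) + 1)) ∧
      ε₀ < Real.sqrt (-tx.1) * ‖v tx.1 tx.2‖ := by
    intro n
    obtain ⟨t, ht, hsmall⟩ := hfreq (1 / ((n : ℝ) + 1)) (by positivity) (min T₀ (-((n : ℝ) + 1)))
    have htT : t < T₀ := lt_of_lt_of_le ht (min_le_left _ _)
    have htn : t < -((n : ℝ) + 1) := lt_of_lt_of_le ht (min_le_right _ _)
    obtain ⟨x, hx⟩ := hbad t htT
    exact ⟨(t, x), htT, htn, hsmall, hx⟩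
  choose tx htT htn hsmall hbig using hch
  set tn : ℕ → ℝ := fun n => (tx n).1 with htn_def
  set xn : ℕ → (EuclideanSpace ℝ (Fin 3)) := fun n => (tx n).2 with hxn_def
  have htn_neg : ∀ n, tn n < 0 := fun n => (htT n).trans hT₀
  -- scales and blow-downs
  set lam : ℕ → ℝ := fun n => Real.sqrt (-(tn n)) with hlam
  have hlam0 : ∀ n, 0 < lam n := fun n => Real.sqrt_pos.2 (neg_pos.2 (htn_neg n))
  have hlam2 : ∀ n, lam n ^ 2 = -(tn n) := fun n => Real.sq_sqrt (neg_nonneg.2 (htn_neg n).le)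
  set w : ℕ → ℝ → (EuclideanSpace ℝ (Fin 3)) → (EuclideanSpace ℝ (Fin 3)) := fun n => lam n • stPull (lam n ^ 2) (lam n) 0 (xn n) v with hw
  have hwcl : ∀ n, IsTypeIAncientMild C (w n) := fun n => isTypeIAncientMild_zoom hv (hlam0 n) (xn n)
  have hw_apply : ∀ n s y, w n s y = lam n • v (lam n ^ 2 * s) (xn n + lam n • y) := fun n s y =>
    zoom_apply (lam n) (xn n) v s y
  -- nontrivial at `(-1, 0)`
  have hw1 : ∀ n, ε₀ < ‖w n (-1) 0‖ := by
    intro n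
    rw [hw_apply, smul_zero, add_zero, mul_neg_one, hlam2, neg_neg, norm_smul,
      Real.norm_of_nonneg (hlam0 n).le]
    exact hbig n
  -- nearly vertical vorticity on the slice `-1`
  have hwcurl : ∀ n y, curl (w n (-1)) y = (lam n * lam n) • curl (v (tn n)) (xn n + lam n • y) := by
    intro n y
    have h := curl_smul_stPull (lam n) (lam n ^ 2) (lam n) 0 (xn n) v (-1) y
    have ht : (0 : ℝ) + lam n ^ 2 * (-1) = tn n := by rw [hlam2]; ring
    rw [ht] at h
    exact h
  have hwsmall : ∀ n y (i : Fin 3), i = 0 ∨ i = 1 → |curl (w n (-1)) y i| ≤ 1 / ((n : ℝ) + 1) := by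
    intro n y i hi
    have hll : lam n * lam n = -(tn n) := by rw [← hlam2]; ring
    rw [hwcurl, PiLp.smul_apply, smul_eq_mul, abs_mul, hll, abs_of_pos (neg_pos.2 (htn_neg n))]
    rcases hi with rfl | rfl
    · exact (hsmall n (xn n + lam n • y)).1
    · exact (hsmall n (xn n + lam n • y)).2
  -- compactness
  obtain ⟨φ, hφ, W, hW, hpt, hptG, -, -⟩ := exists_tendsto_of_isTypeIAncientMild_seq C hwcl
  -- `‖W(-1, 0)‖ ≥ ε₀`
  have hW1 : ε₀ ≤ ‖W (-1) 0‖ :=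
    ge_of_tendsto ((hpt (-1) (by norm_num) 0).norm) (Eventually.of_forall fun j => (hw1 (φ j)).le)
  -- `curl W(-1) ∥ e₃`
  have hcurl0 : ∀ y (i : Fin 3), i = 0 ∨ i = 1 → curl (W (-1)) y i = 0 := by
    intro y i hi
    have hc : Tendsto (fun j => curl (w (φ j) (-1)) y i) atTop (𝓝 (curl (W (-1)) y i)) :=
      (continuous_apply i |>.continuousAt.tendsto.comp
        ((PiLp.continuous_ofLp 2 _).continuousAt.tendsto.comp
          (tendsto_curl_of_tendsto_fderiv (hptG (-1) (by norm_num) y))))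
    have hlim : Tendsto (fun j : ℕ => 1 / (((φ j : ℕ) : ℝ) + 1)) atTop (𝓝 0) := by
      have h1 : Tendsto (fun j : ℕ => ((φ j : ℕ) : ℝ) + 1) atTop atTop :=
        (tendsto_natCast_atTop_atTop.comp hφ.tendsto_atTop).atTop_add tendsto_const_nhds
      have h2 := h1.inv_tendsto_atTop
      refine h2.congr fun j => ?_
      simp only [Pi.inv_apply, one_div]
    have habs : Tendsto (fun j => |curl (w (φ j) (-1)) y i|) atTop (𝓝 0) :=
      squeeze_zero (fun j => abs_nonneg _) (fun j => hwsmall (φ j) y i hi) hlim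
    have h2 : Tendsto (fun j => |curl (w (φ j) (-1)) y i|) atTop (𝓝 |curl (W (-1)) y i|) := hc.abs
    exact abs_eq_zero.1 (tendsto_nhds_unique h2 habs)
  have hpar : ∀ y, ∃ a : ℝ, curl (W (-1)) y = a • e3 := fun y =>
    ⟨curl (W (-1)) y 2, eq_smul_e3_of_apply_eq_zero (hcurl0 y 0 (Or.inl rfl)) (hcurl0 y 1 (Or.inr rfl))⟩
  have he3 : (e3 : (EuclideanSpace ℝ (Fin 3))) ≠ 0 := by
    intro h
    have := congrArg (fun w : (EuclideanSpace ℝ (Fin 3)) => w 2) h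
    simp [e3] at this
  -- ancient Barker–Prange on the limit
  have hW0 := eq_zero_of_curl_parallel_slice hW (by norm_num : (-1 : ℝ) < 0) he3 hpar (-1) (by norm_num) 0
  rw [hW0, norm_zero] at hW1
  exact absurd hW1 (not_le.2 hε₀)

/-- **MAIN — frequently vertical vorticity kills, door form.**  A profile of the route's Type-I ancient Oseen-mild class
(Type-I time rate, continuity on the open slab, unit-viscosity Oseen–Duhamel identity between negative times,
divergence-free slices) whose scale-invariant horizontal vorticity `(−t)(|ω₁|, |ω₂|)` is `ε`-small everywhere at some time
below every `T`, for every `ε > 0`, vanishes identically.  No sign hypothesis. -/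
theorem eq_zero_of_frequently_vertical_vorticity {v : ℝ → (EuclideanSpace ℝ (Fin 3)) → (EuclideanSpace ℝ (Fin 3))} (hrate : HasTypeITimeDecay C v)
    (hcont : ContinuousOn (uncurry v) (Iio (0 : ℝ) ×ˢ univ))
    (hmild : ∀ s t : ℝ, s < t → t < 0 → ∀ x,
      v t x = UnboundedOperators.heatExtension (v s) (t - s) x - oseenDuhamel 1 s v v t x)
    (hdiv : ∀ t < 0, VectorCalculus.IsDivFree (v t))
    (hfreq : ∀ ε > 0, ∀ T : ℝ, ∃ t < T, ∀ x,
      (-t) * |curl (v t) x 0| ≤ ε ∧ (-t) * |curl (v t) x 1| ≤ ε) :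
    ∀ t < 0, ∀ x, v t x = 0 :=
  eq_zero_of_frequently_vertical_vorticity_class (isTypeIAncientMild_of_class hrate hcont hmild hdiv) hfreq

/-- **FAR-PAST HORIZONTAL-VORTICITY FLOOR.**  A NONTRIVIAL profile of the route's Type-I ancient Oseen-mild class carries
`ε₁ > 0` and `T < 0` such that EVERY slice `t < T` has a point where the scale-invariant horizontal vorticity is large:
`ε₁ < (−t)(|curl v(t)(x)₀| + |curl v(t)(x)₁|)`. -/
theorem farPast_horizontalVorticity_floor {v : ℝ → (EuclideanSpace ℝ (Fin 3)) → (EuclideanSpace ℝ (Fin 3))} (hrate : HasTypeITimeDecay C v)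
    (hcont : ContinuousOn (uncurry v) (Iio (0 : ℝ) ×ˢ univ))
    (hmild : ∀ s t : ℝ, s < t → t < 0 → ∀ x,
      v t x = UnboundedOperators.heatExtension (v s) (t - s) x - oseenDuhamel 1 s v v t x)
    (hdiv : ∀ t < 0, VectorCalculus.IsDivFree (v t))
    (hne : ∃ t < 0, ∃ x, v t x ≠ 0) :
    ∃ ε₁ : ℝ, 0 < ε₁ ∧ ∃ T : ℝ, T < 0 ∧ ∀ t < T, ∃ x,
      ε₁ < (-t) * (|curl (v t) x 0| + |curl (v t) x 1|) := by
  by_contra hcon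
  push Not at hcon
  obtain ⟨t₁, ht₁, x₁, hx₁⟩ := hne
  refine hx₁ (eq_zero_of_frequently_vertical_vorticity hrate hcont hmild hdiv (fun ε hε T => ?_) t₁ ht₁ x₁)
  obtain ⟨t, ht, h⟩ := hcon ε hε (min T (-1)) (lt_of_le_of_lt (min_le_right _ _) (by norm_num))
  refine ⟨t, lt_of_lt_of_le ht (min_le_left _ _), fun x => ?_⟩
  have ht0 : 0 < -t := by
    have : t < -1 := lt_of_lt_of_le ht (min_le_right _ _)
    linarith
  have hx := h x
  have h0 : 0 ≤ (-t) * |curl (v t) x 0| := by positivity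
  have h1 : 0 ≤ (-t) * |curl (v t) x 1| := by positivity
  constructor <;> nlinarith [hx, h0, h1, mul_add (-t) (|curl (v t) x 0|) (|curl (v t) x 1|)]

/-! ### Census corollaries for crux 25311 -/

/-- **CENSUS ROW (W6 on the stratum «frequently asymptotically vertical vorticity», sign-free).**  A door-class profile whose
scale-invariant horizontal vorticity is `ε`-small everywhere at some time below every `T`, for every `ε`, is poloidal along
`e₃` (indeed zero): `⟪curl v(s), e₃⟫ ≡ 0`. -/
theorem inner_curl_e3_eq_zero_of_frequently_vertical_vorticity {v : ℝ → (EuclideanSpace ℝ (Fin 3)) → (EuclideanSpace ℝ (Fin 3))} (hrate : HasTypeITimeDecay C v)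
    (hcont : ContinuousOn (uncurry v) (Iio (0 : ℝ) ×ˢ univ))
    (hmild : ∀ s t : ℝ, s < t → t < 0 → ∀ x,
      v t x = UnboundedOperators.heatExtension (v s) (t - s) x - oseenDuhamel 1 s v v t x)
    (hdiv : ∀ t < 0, VectorCalculus.IsDivFree (v t))
    (hfreq : ∀ ε > 0, ∀ T : ℝ, ∃ t < T, ∀ x,
      (-t) * |curl (v t) x 0| ≤ ε ∧ (-t) * |curl (v t) x 1| ≤ ε) :
    ∀ s < 0, ∀ y, ⟪curl (v s) y, e3⟫ = 0 := by
  intro s hs y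
  have heq : v s = fun _ => (0 : (EuclideanSpace ℝ (Fin 3))) :=
    funext fun x => eq_zero_of_frequently_vertical_vorticity hrate hcont hmild hdiv hfreq s hs x
  have hcurl : curl (v s) y = 0 := by
    rw [heq]
    ext i
    fin_cases i <;> simp [curl]
  rw [hcurl, inner_zero_left]

/-- **W6 restricted to the stratum, bundled form** (`InDoorClass` of `…Defs`). -/
theorem hemisphereLiouvilleE3_of_frequently_vertical_vorticity {v : ℝ → (EuclideanSpace ℝ (Fin 3)) → (EuclideanSpace ℝ (Fin 3))} (hv : InDoorClass C v)
    (hfreq : ∀ ε > 0, ∀ T : ℝ, ∃ t < T, ∀ x,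
      (-t) * |curl (v t) x 0| ≤ ε ∧ (-t) * |curl (v t) x 1| ≤ ε) :
    ∀ s < 0, ∀ y, ⟪curl (v s) y, e3⟫ = 0 :=
  inner_curl_e3_eq_zero_of_frequently_vertical_vorticity hv.1 hv.2.1 hv.2.2.1 hv.2.2.2 hfreq

/-- **THE ENEMY'S TILTING FUEL NEVER RUNS OUT AT SCALE.**  A circulation-carrying closed-hemisphere door-class profile (the
hypotheses of `HemisphereLiouvilleE3` plus `⟪curl v(s₁)(y₁), e₃⟫ > 0` somewhere — the object W6 says does not exist) has the
far-past horizontal-vorticity floor: `ε₁ > 0`, `T < 0` with `∃ x, ε₁ < (−t)(|ω₁(t,x)| + |ω₂(t,x)|)` on every slice `t < T`.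
(The sign hypothesis is carried only to name the enemy; the floor needs nontriviality alone.) -/
theorem enemy_horizontalVorticity_floor {v : ℝ → (EuclideanSpace ℝ (Fin 3)) → (EuclideanSpace ℝ (Fin 3))} (hv : InDoorClass C v) (_hsign : SignE3 v)
    (hpos : ∃ s < 0, ∃ y, 0 < ⟪curl (v s) y, e3⟫) :
    ∃ ε₁ : ℝ, 0 < ε₁ ∧ ∃ T : ℝ, T < 0 ∧ ∀ t < T, ∃ x,
      ε₁ < (-t) * (|curl (v t) x 0| + |curl (v t) x 1|) := by
  refine farPast_horizontalVorticity_floor hv.1 hv.2.1 hv.2.2.1 hv.2.2.2 ?_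
  obtain ⟨s, hs, y, hy⟩ := hpos
  by_contra hne
  push Not at hne
  have heq : v s = fun _ => (0 : (EuclideanSpace ℝ (Fin 3))) := funext fun x => hne s hs x
  have hcurl : curl (v s) y = 0 := by
    rw [heq]
    ext i
    fin_cases i <;> simp [curl]
  rw [hcurl, inner_zero_left] at hy
  exact lt_irrefl _ hy

end Summit.NavierStokesRegularity.NavierStokesRegularity.Theorems.HalfSpaceWindowDoorCirculationCarryingRigidityHorizontalVorticityFloor

end
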